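import Literature.NumberTheory.DiophantineGeometry.AbcWave0SUnitProofs
import Summits.ABC.ABC.Theses.IneffectiveSubspace

/-!
# Stub `stub_boundedRadicalCell` of line `Sketch` — crux `IneffectiveSubspace.DepthCountedABC` (stmt-ABC-14938)

THE BOUNDED-RADICAL FIBRES.  The crux asks for abc (`c < C · rad(abc)^(1+ε)`) on the cells
`ω₅(abc) ≤ K`.  This stub records that the fibres `{rad(abc) ≤ R}` are bounded sets of abc triples
(Mahler 1933: finiteness of the `S`-unit equation over `ℚ`, PROVED in the tree as
`Literature.NumberTheory.DiophantineGeometry.finite_setOf_isABCTriple_primeFactors_subset_holds`),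
hence abc holds on them with any exponent.

* Part 1 (`c ≤ B(R)` on the fibre `rad(abc) ≤ R`): every prime `p` of `abc` is a prime of
  `rad(abc) = radical (a*b*c)` (`Nat.primeFactors_radical`), so `p ≤ rad(abc) ≤ R` and
  `(abc).primeFactors ⊆ {0, …, R}`.  The abc triples with that support form a finite set
  (`finite_setOf_isABCTriple_primeFactors_subset_holds (Finset.range (R+1))`), and the image of a
  finite set of triples under `(a, b, c) ↦ c` is bounded above.
* Part 2 (`c < C · rad(abc)^(1+ε)` on the fibre): with `B` from part 1 take `C := B + 1`; then
  `c ≤ B < B + 1 ≤ (B + 1) · rad(abc)^(1+ε)` since `rad(abc) ≥ 1` (`Nat.radical_pos`) gives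
  `1 ≤ rad(abc)^(1+ε)` (`Real.one_le_rpow`).

Sources: skeleton `work/DepthCountedABC.lean` of lead `prover-line-stmt-ABC-14938-c10-0`
(stub `stub_boundedRadicalCell`).  Ingredients: the PROVED fact
`finite_setOf_isABCTriple_primeFactors_subset_holds`
(`Literature/NumberTheory/DiophantineGeometry/AbcWave0SUnitProofs.lean`), `rad_def`; Mathlib
(`Nat.primeFactors_radical`, `Nat.le_of_mem_primeFactors`, `Set.Finite.subset`, `Set.Finite.image`,
`Set.Finite.bddAbove`, `Nat.radical_pos`, `Real.one_le_rpow`).  Deliberately NOT here: the other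
stubs of the line (Ridout small member, rough-powerful-cell normal form, LW-deep dictionary, the
three cores).
-/

-- `Summit.<Summit>.<Problem>` is the mandated summit-side namespace (CONVENTIONS §2); for the
-- single-conjunct summit `ABC` the two coincide, so the duplicate `ABC.ABC` is deliberate.
set_option linter.dupNamespace false

namespace Summit.ABC.ABC.Theorems.DepthCountedABC

/-- On the fibre `rad(abc) ≤ R` every prime of `abc` is at most `R`
(`(radical n).primeFactors = n.primeFactors`, `Nat.primeFactors_radical`). [folklore] -/
theorem boundedRadicalCell_primeFactors_subset {a b c R : ℕ}
    (hR : Literature.NumberTheory.DiophantineGeometry.rad a b c ≤ R) :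
    (a * b * c).primeFactors ⊆ Finset.range (R + 1) := by
  -- adapted from `IneffectiveSubspaceDepthCountedABCStubFibreBaker.lean`
  -- (`fibreBaker_primeFactors_subset`)
  intro p hp
  rw [Literature.NumberTheory.DiophantineGeometry.rad_def] at hR
  rw [← Nat.primeFactors_radical] at hp
  exact Finset.mem_range.mpr (Nat.lt_succ_of_le ((Nat.le_of_mem_primeFactors hp).trans hR))

/-- **Mahler 1933 on a bounded-radical fibre.**  For every `R` there is `B` with `c ≤ B` for every
abc triple `(a, b, c)` with `rad(abc) ≤ R`: such triples have all primes of `abc` in `{0, …, R}`,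
and the abc triples with support in a fixed finite set form a finite set
(`finite_setOf_isABCTriple_primeFactors_subset_holds`). [cite: Mahler1933] -/
theorem boundedRadicalCell_bounded (R : ℕ) :
    ∃ B : ℕ, ∀ a b c : ℕ, Literature.NumberTheory.DiophantineGeometry.IsABCTriple a b c →
      Literature.NumberTheory.DiophantineGeometry.rad a b c ≤ R → c ≤ B := by
  have hfin :=
    Literature.NumberTheory.DiophantineGeometry.finite_setOf_isABCTriple_primeFactors_subset_holds
      (Finset.range (R + 1))
  obtain ⟨B, hB⟩ := (hfin.image (fun t : ℕ × ℕ × ℕ => t.2.2)).bddAbove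
  refine ⟨B, fun a b c habc hR => hB ?_⟩
  exact ⟨(a, b, c), ⟨habc, boundedRadicalCell_primeFactors_subset hR⟩, rfl⟩

/-- **Stub `stub_boundedRadicalCell` (BOUNDED-RADICAL FIBRES) of line `Sketch`, crux
`DepthCountedABC` (stmt-ABC-14938):** (1) for every `R` some `B` bounds `c ≤ B` on every abc triple
with `rad(abc) ≤ R` (Mahler 1933, via the tree-proved
`finite_setOf_isABCTriple_primeFactors_subset_holds`); (2) hence for every `R` and `ε > 0` some
`C > 0` gives `c < C · rad(abc)^(1+ε)` on every abc triple with `rad(abc) ≤ R`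
(`C := B + 1`, using `rad(abc) ≥ 1`). [cite: Mahler1933] -/
theorem stub_boundedRadicalCell :
    (∀ R : ℕ, ∃ B : ℕ, ∀ a b c : ℕ, Literature.NumberTheory.DiophantineGeometry.IsABCTriple a b c →
      Literature.NumberTheory.DiophantineGeometry.rad a b c ≤ R → c ≤ B) ∧
    (∀ R : ℕ, ∀ ε : ℝ, 0 < ε → ∃ C : ℝ, 0 < C ∧ ∀ a b c : ℕ,
      Literature.NumberTheory.DiophantineGeometry.IsABCTriple a b c →
      Literature.NumberTheory.DiophantineGeometry.rad a b c ≤ R →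
      (c : ℝ) < C * ((Literature.NumberTheory.DiophantineGeometry.rad a b c : ℕ) : ℝ) ^ (1 + ε)) := by
  refine ⟨boundedRadicalCell_bounded, fun R ε hε => ?_⟩
  obtain ⟨B, hB⟩ := boundedRadicalCell_bounded R
  have hB0 : (0 : ℝ) ≤ (B : ℝ) := Nat.cast_nonneg B
  refine ⟨(B : ℝ) + 1, by linarith, fun a b c habc hR => ?_⟩
  have hcB : (c : ℝ) ≤ (B : ℝ) := by exact_mod_cast hB a b c habc hR
  have hrad1 : (1 : ℝ) ≤ ((Literature.NumberTheory.DiophantineGeometry.rad a b c : ℕ) : ℝ) := by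
    rw [Literature.NumberTheory.DiophantineGeometry.rad_def]
    exact_mod_cast Nat.radical_pos (a * b * c)
  have hpow : (1 : ℝ) ≤
      ((Literature.NumberTheory.DiophantineGeometry.rad a b c : ℕ) : ℝ) ^ (1 + ε) :=
    Real.one_le_rpow hrad1 (by linarith)
  have hC1 : (0 : ℝ) < (B : ℝ) + 1 := by linarith
  calc (c : ℝ) ≤ (B : ℝ) := hcB
    _ < (B : ℝ) + 1 := lt_add_one _
    _ = ((B : ℝ) + 1) * 1 := (mul_one _).symm
    _ ≤ ((B : ℝ) + 1) *
          ((Literature.NumberTheory.DiophantineGeometry.rad a b c : ℕ) : ℝ) ^ (1 + ε) :=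
        mul_le_mul_of_nonneg_left hpow hC1.le

end Summit.ABC.ABC.Theorems.DepthCountedABC
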